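import Summits.AtomisticToContinuum.HydrodynamicLimit.Theses.MourreKoopmanCharges
import Literature.MathematicalPhysics.KineticTheory.HardSphereGasFluctuations
import Literature.MathematicalPhysics.KineticTheory.RegularStationaryState
import Literature.Analysis.FluidPDE.InfiniteHardSphereKoopman
import HarnessLib

/-!
# `StressStrongMixing` · line `birth`, stub A `stub_stressFramework`:
# assembly of the density-one hard-sphere fluctuation data from its three infinite-volume inputs

Support file for the crux item stmt-AtomisticToContinuum-9584 (`StressStrongMixing`, route
`MourreKoopmanCharges` of `AtomisticToContinuum/HydrodynamicLimit`), serving the registered stub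
`stub_stressFramework` (A) of the skeleton `Cruxes/StressStrongMixing/Lines/birth.lean`:

  `∃ σ₀ > 0, ∀ σ ∈ (0, σ₀), ∀ θ > 0, ∃ z > 0, ∃ F : HardSphereFluctuationData σ,`
  `IsHardSphereGibbs σ z θ⁻¹ 0 F.μ ∧ ∫ cellCharge 0 dF.μ = 1 ∧`
  `(∃ Φ, Φ.IsEquilibriumFlow ∧ ∀ t, F.flow t =ᵐ[F.μ] Φ.flow t) ∧ cellObs (v ↦ v⁰v¹) ∈ F.localObs`.

The stub is NOT closed here (no infinite-volume hard-sphere Gibbs state is constructed anywhere in the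
tree: `HardSphereGibbsState.lean`, "Deliberately NOT here"; the only sources are the unproved named
facts `RuelleDiluteHardSphereGas` / `Georgii1995_hardSphereCanonicalLocalLimit`, both at UNIT diameter,
and Alexander's theorem `InfiniteHardSphereFlow.nonempty` is a named fact as well).  What this file
proves is the honest REDUCTION of the stub to three infinite-volume inputs, each typed over tree
carriers only:

* (F1) a translation-invariant DLR state of the hard-sphere gas at diameter `σ`, `β = θ⁻¹`, zero drift,
  of density EXACTLY one (`PointProcess.density μ = 1`; Ruelle 1969 Thm 4.2.3 at unit diameter and
  density `σ³` — the named fact `RuelleDiluteHardSphereGas` plus the intermediate value theorem on the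
  density — rescaled by `x ↦ σ x`; no such rescaling of DLR states is in the tree);
* (F2) Alexander's theorem BY NAME, `InfiniteHardSphereFlow.nonempty (d := Fin 3)` (an equilibrium
  flow: a.e. defined and stationary for every Gibbs state), together with (Fcov) almost-sure
  commutation of equilibrium flows with the spatial translations under Gibbs states (Alexander 1976
  Cor 5.4 `InfiniteHardSphereFlow.unique` with the translation covariance of the specification and of
  `Tᵗ = lim_r T_rᵗ`; the tree's pointwise `IsTranslationCovariant` is the stronger form, also handled);
* (F3) admissibility of the flow–shift span of the local polynomial observables
  (`IsLocalObservableSpace Φ μ (hardSphereObs Φ)`: square integrability, space-summable truncated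
  correlations of TIME-EVOLVED local observables at fixed packing, non-negative structure factor —
  Spohn 1991 Part I §7.1, Condition 2.1; the genuinely open input).

Proved here: the kinetic shear stress of the unit cell is a local polynomial observable, hence lies in
`hardSphereObs Φ` (`cellObs_shearStress_mem_hardSphereObs`); the number charge of the unit cell is the
particle count, so that for a law carried by hard-sphere configurations `∫ cellCharge 0 dμ` is the
(real part of the) density `PointProcess.density μ` (`integral_cellCharge_zero_eq_toReal_density`);
and the assembly `F := (IsFluctuationSetting.of_gibbs …).fluctuationData` satisfies the four clauses of
the stub (`exists_framework_of_ae`, `exists_framework_of_setting`, `stressFramework_of`).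

References: H. Spohn, *Large Scale Dynamics of Interacting Particles* (1991), Part I §7.1 (7.4)–(7.7);
R. Alexander, Comm. Math. Phys. 49 (1976), Thm 5.2; D. Ruelle, *Statistical Mechanics* (1969), Thm 4.2.3.
-/

noncomputable section

open MeasureTheory ProbabilityTheory Filter Topology
open scoped InnerProductSpace ENNReal

namespace Summit.AtomisticToContinuum.HydrodynamicLimit.Theorems.MourreKoopmanChargesStressStrongMixing

open Literature.MathematicalPhysics.KineticTheory Literature.Analysis.FluidPDE
open Literature.Analysis.FunctionSpaces (PointConfig)

/-! ### The kinetic shear stress of the unit cell is a local polynomial observable -/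

/-- `|v⁰ v¹| ≤ (1 + ‖v‖)²` (each coordinate is bounded by the Euclidean norm). [folklore] -/
theorem abs_shearStress_le (v : V3) : |v 0 * v 1| ≤ 1 * (1 + ‖v‖) ^ 2 := by
  have h0 : |v 0| ≤ ‖v‖ := by simpa only [Real.norm_eq_abs] using PiLp.norm_apply_le v 0
  have h1 : |v 1| ≤ ‖v‖ := by simpa only [Real.norm_eq_abs] using PiLp.norm_apply_le v 1
  have hn : 0 ≤ ‖v‖ := norm_nonneg v
  rw [abs_mul, one_mul]
  calc |v 0| * |v 1| ≤ ‖v‖ * ‖v‖ := mul_le_mul h0 h1 (abs_nonneg _) hn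
    _ ≤ (1 + ‖v‖) ^ 2 := by nlinarith

/-- **The shear-stress cell observable `Σ_{q ∈ [0,1)³} v⁰ v¹` is a local polynomial observable**
(base `[0,1)³`, quadratic growth in the velocity). [folklore] -/
theorem isLocalPolyObs_cellObs_shearStress : IsLocalPolyObs (cellObs fun v : V3 => v 0 * v 1) :=
  isLocalPolyObs_cellObs (show Continuous fun v : V3 => v 0 * v 1 by fun_prop).measurable
    ⟨1, 2, abs_shearStress_le⟩

/-- Hence the shear-stress cell observable belongs to the observable space `hardSphereObs Φ` (the
flow–shift span of the local polynomial observables) of every infinite hard-sphere flow `Φ`. [folklore] -/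
theorem cellObs_shearStress_mem_hardSphereObs {σ : ℝ} (Φ : InfiniteHardSphereFlow (Fin 3) σ) :
    cellObs (fun v : V3 => v 0 * v 1) ∈ hardSphereObs Φ :=
  mem_hardSphereObs_of_isLocalPolyObs Φ isLocalPolyObs_cellObs_shearStress

/-! ### The number charge of the unit cell is the particle count; its mean is the density -/

/-- `∑ᶠ_{p ∈ s} 1 = #s` in `ℝ` (both sides vanish for infinite `s`). [folklore] -/
theorem finsum_mem_one_real {α : Type*} (s : Set α) : ∑ᶠ _p ∈ s, (1 : ℝ) = (s.ncard : ℝ) := by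
  rcases s.finite_or_infinite with hs | hs
  · rw [finsum_mem_eq_finite_toFinset_sum _ hs, Finset.sum_const, nsmul_eq_mul, mul_one,
      Set.ncard_eq_toFinset_card s hs]
  · rw [hs.ncard, Nat.cast_zero]
    exact finsum_mem_eq_zero_of_infinite (by simpa [Function.support_const one_ne_zero] using hs)

/-- **The number charge of the unit cell is the particle count**:
`cellCharge 0 ω = #{(q, v) ∈ ω | q ∈ [0,1)³}` (as a natural number cast to `ℝ`; both sides are `0`
when infinitely many particles lie over the cell). [folklore] -/
theorem cellCharge_zero_eq_ncard (ω : MarkedConfig) :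
    cellCharge 0 ω = ((((ω : Set (V3 × V3)) ∩ Prod.fst ⁻¹' unitCell).ncard : ℕ) : ℝ) := by
  have h1 : cellCharge 0 ω =
      ∑ᶠ p ∈ (ω : Set (V3 × V3)), (Prod.fst ⁻¹' unitCell).indicator (fun _ => (1 : ℝ)) p := by
    simp only [cellCharge, cellObs, linStat_def]
    refine finsum_mem_congr rfl fun p _ => ?_
    rw [show chargeFn 0 p.2 = 1 from rfl]
    exact (Set.indicator_comp_right (Prod.fst : V3 × V3 → V3) (g := fun _ : V3 => (1 : ℝ))).symm
  rw [h1, finsum_mem_def, Set.indicator_indicator, ← finsum_mem_def, finsum_mem_one_real]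

/-- The unit cell of `FluctuationSpace.lean` is the unit cube `[0,1)³` of the point-process statics. [folklore] -/
theorem unitCell_eq_unitCube : unitCell = Literature.Analysis.FunctionSpaces.Torus.unitCube (Fin 3) := rfl

/-- **For a law carried by hard-sphere configurations, the mean number charge of the unit cell is
the density**: `∫ cellCharge 0 dμ = (PointProcess.density μ).toReal` (a hard-sphere configuration
has finitely many particles over the bounded cell, so `cellCharge 0 = N([0,1)³ × ℝ³)` a.s.; then
`∫ N.toReal = (∫⁻ N).toReal`, both sides being `0` when the density is infinite). [folklore] -/
theorem integral_cellCharge_zero_eq_toReal_density {σ : ℝ} (hσ : 0 < σ) {μ : Measure MarkedConfig}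
    (hcore : ∀ᵐ ω ∂μ, IsHardCore σ ω) :
    ∫ ω, cellCharge 0 ω ∂μ = (PointProcess.density μ).toReal := by
  -- almost surely finitely many particles lie over the unit cell
  have hfin : ∀ᵐ ω : MarkedConfig ∂μ, ((ω : Set (V3 × V3)) ∩ Prod.fst ⁻¹' unitCell).Finite := by
    filter_upwards [hcore] with ω hω
    exact (hω.posLocallyFinite hσ).finite_particlesIn isBounded_unitCell
  -- so the number charge is the (finite) count, almost surely
  have hae : (fun ω : MarkedConfig => cellCharge 0 ω) =ᵐ[μ] fun ω =>
      (((ω.count (Prod.fst ⁻¹' Literature.Analysis.FunctionSpaces.Torus.unitCube (Fin 3)) : ℕ∞) :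
        ℝ≥0∞)).toReal := by
    filter_upwards [hfin] with ω hω
    rw [cellCharge_zero_eq_ncard, PointConfig.count, ← unitCell_eq_unitCube,
      ← PointConfig.coe_eq_carrier, ← hω.cast_ncard_eq, ENat.toENNReal_coe, ENNReal.toReal_natCast]
  rw [integral_congr_ae hae, PointProcess.density]
  refine integral_toReal ?_ ?_
  · exact (Measurable.of_discrete.comp (PointConfig.measurable_count
      (Literature.Analysis.FunctionSpaces.Torus.measurableSet_unitCube.preimage measurable_fst))).aemeasurable
  · filter_upwards [hfin] with ω hω
    rw [ENat.toENNReal_lt_top, PointConfig.count, ← unitCell_eq_unitCube, ← PointConfig.coe_eq_carrier]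
    exact hω.encard_lt_top

/-! ### Assembly of the framework -/

/-- **The framework at fixed parameters, almost-everywhere form.** Given, at reduced diameter
`σ > 0` and temperature `θ > 0`: a translation-invariant Gibbs state `μ` of the hard-sphere gas at
activity `z > 0`, inverse temperature `θ⁻¹`, zero drift, of density one; an equilibrium Alexander flow
`Φ` (a.e. defined and stationary for every Gibbs state) commuting with the spatial translations
`μ`-almost everywhere; and an admissible observable space `𝒱` (`IsLocalObservableSpace Φ μ 𝒱`: square
integrable, flow- and shift-stable, space-summable truncated correlations, non-negative structure
factor, containing the five cell charges) containing the shear-stress cell observable — the fluctuation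
data `Φ.fluctuationData ⟨μ, 𝒱, …⟩` (state `μ`, observables `𝒱`, flow `Φ`; hard core a.s. PROVED from the
flow axioms) satisfies the four clauses of stub A; the density clause is
`integral_cellCharge_zero_eq_toReal_density`. [folklore] -/
theorem exists_framework_of_ae {σ θ z : ℝ} (hσ : 0 < σ) (hθ : 0 < θ) (hz : 0 < z)
    {μ : Measure MarkedConfig} (hμ : IsHardSphereGibbs σ z θ⁻¹ (0 : V3) μ)
    (hti : IsTranslationInvariant μ) (hρ : PointProcess.density μ = 1)
    {Φ : InfiniteHardSphereFlow (Fin 3) σ} (hΦ : Φ.IsEquilibriumFlow)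
    (hcomm : ∀ (t : ℝ) (x : V3), Φ.flow t ∘ spatialShift x =ᵐ[μ] spatialShift x ∘ Φ.flow t)
    {𝒱 : Submodule ℝ (MarkedConfig → ℝ)} (h𝒱 : IsLocalObservableSpace Φ μ 𝒱)
    (hstress : cellObs (fun v : V3 => v 0 * v 1) ∈ 𝒱) :
    ∃ F : HardSphereFluctuationData σ,
      IsHardSphereGibbs σ z θ⁻¹ (0 : V3) F.μ ∧
      (∫ ω, cellCharge 0 ω ∂F.μ = 1) ∧
      (∃ Φ : InfiniteHardSphereFlow (Fin 3) σ, Φ.IsEquilibriumFlow ∧ ∀ t : ℝ, F.flow t =ᵐ[F.μ] Φ.flow t) ∧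
      cellObs (fun v : V3 => v 0 * v 1) ∈ F.localObs := by
  have hβ : 0 < θ⁻¹ := inv_pos.2 hθ
  -- the static fluctuation structure of `(μ, 𝒱)`
  let S : FluctuationStructure (volume : Measure V3) spatialShift :=
    { μ := μ
      isProbabilityMeasure := hμ.1
      measurePreserving_shift := fun x => ⟨PointConfig.measurable_translate _, hti x⟩
      localObs := 𝒱
      memLp_of_mem := h𝒱.memLp
      comp_shift_mem := h𝒱.comp_shift_mem
      integrable_cov := h𝒱.integrable_cov
      form_self_nonneg := h𝒱.form_self_nonneg }
  have hP : Φ.IsAEDefined S.μ := hΦ.isAEDefined hz hβ hμ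
  have hS : Φ.IsStationary S.μ := hΦ.isStationary hz hβ hμ
  refine ⟨Φ.fluctuationData S hP hS hcomm h𝒱.comp_flow_mem h𝒱.cellCharge_mem, hμ, ?_,
    ⟨Φ, hΦ, fun t => Filter.EventuallyEq.rfl⟩, hstress⟩
  change ∫ ω, cellCharge 0 ω ∂μ = 1
  rw [integral_cellCharge_zero_eq_toReal_density hσ (Φ.isHardCore_ae hP), hρ, ENNReal.toReal_one]

/-- **The framework at fixed parameters, pointwise-covariant form**: as `exists_framework_of_ae`,
with the flow commuting with the translations on its good set (`IsTranslationCovariant`), via the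
tree's bundled constructor `IsFluctuationSetting.of_gibbs … |>.fluctuationData`. [folklore] -/
theorem exists_framework_of_setting {σ θ z : ℝ} (hσ : 0 < σ) (hθ : 0 < θ) (hz : 0 < z)
    {μ : Measure MarkedConfig} (hμ : IsHardSphereGibbs σ z θ⁻¹ (0 : V3) μ)
    (hti : IsTranslationInvariant μ) (hρ : PointProcess.density μ = 1)
    {Φ : InfiniteHardSphereFlow (Fin 3) σ} (hΦ : Φ.IsEquilibriumFlow) (hcov : Φ.IsTranslationCovariant)
    {𝒱 : Submodule ℝ (MarkedConfig → ℝ)} (h𝒱 : IsLocalObservableSpace Φ μ 𝒱)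
    (hstress : cellObs (fun v : V3 => v 0 * v 1) ∈ 𝒱) :
    ∃ F : HardSphereFluctuationData σ,
      IsHardSphereGibbs σ z θ⁻¹ (0 : V3) F.μ ∧
      (∫ ω, cellCharge 0 ω ∂F.μ = 1) ∧
      (∃ Φ : InfiniteHardSphereFlow (Fin 3) σ, Φ.IsEquilibriumFlow ∧ ∀ t : ℝ, F.flow t =ᵐ[F.μ] Φ.flow t) ∧
      cellObs (fun v : V3 => v 0 * v 1) ∈ F.localObs := by
  have hset : IsFluctuationSetting Φ μ 𝒱 :=
    IsFluctuationSetting.of_gibbs hΦ hcov hz (inv_pos.2 hθ) hμ hti h𝒱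
  refine ⟨hset.fluctuationData, hμ, ?_, ⟨Φ, hΦ, fun t => Filter.EventuallyEq.rfl⟩, hstress⟩
  rw [IsFluctuationSetting.fluctuationData_μ,
    integral_cellCharge_zero_eq_toReal_density hσ (Φ.isHardCore_ae hset.aeDefined), hρ, ENNReal.toReal_one]

/-! ### The reduction of stub A to named-fact-shaped infinite-volume inputs -/

/-- **Stub A from its infinite-volume inputs** (thresholds combined by `min`; the observable space is
the canonical `hardSphereObs Φ`, which contains the shear stress by `cellObs_shearStress_mem_hardSphereObs`):
(F1) for small reduced diameter `σ` and every temperature `θ`, a translation-invariant DLR state of the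
hard-sphere gas of diameter `σ` at some activity `z > 0`, inverse temperature `θ⁻¹`, zero drift, of
density exactly one (Ruelle 1969 Thm 4.2.3 / Dobrushin–Sinai–Sukhov §2.4 at unit diameter and density
`σ³` — the tree's named fact `RuelleDiluteHardSphereGas` with the intermediate value theorem — rescaled
by `x ↦ σ x`); (F2) Alexander's theorem BY NAME, `InfiniteHardSphereFlow.nonempty (d := Fin 3)`;
(Fcov) every equilibrium flow commutes with the spatial translations almost surely under every Gibbs
state (Alexander 1976 Cor 5.4, `InfiniteHardSphereFlow.unique`, with the translation covariance of the
DLR specification and of Alexander's `Tᵗ = lim_r T_rᵗ`); (F3) for small `σ`, admissibility of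
`hardSphereObs Φ` for every equilibrium flow and every translation-invariant density-one Gibbs state at
diameter `σ` (space-summable clustering of time-evolved local observables at fixed packing
`(π/6)σ³`; Spohn 1991 Part I §7.1, Condition 2.1 — the open input). [folklore] -/
theorem stressFramework_of :
    (∃ σ₁ : ℝ, 0 < σ₁ ∧ ∀ σ : ℝ, 0 < σ → σ < σ₁ → ∀ θ : ℝ, 0 < θ →
      ∃ z : ℝ, 0 < z ∧ ∃ μ : Measure MarkedConfig,
        IsHardSphereGibbs σ z θ⁻¹ (0 : V3) μ ∧ IsTranslationInvariant μ ∧ PointProcess.density μ = 1) →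
    InfiniteHardSphereFlow.nonempty (d := Fin 3) →
    (∀ σ : ℝ, 0 < σ → ∀ Φ : InfiniteHardSphereFlow (Fin 3) σ, Φ.IsEquilibriumFlow →
      ∀ z β : ℝ, 0 < z → 0 < β → ∀ μ : Measure MarkedConfig, IsHardSphereGibbs σ z β (0 : V3) μ →
        ∀ (t : ℝ) (x : V3), Φ.flow t ∘ spatialShift x =ᵐ[μ] spatialShift x ∘ Φ.flow t) →
    (∃ σ₃ : ℝ, 0 < σ₃ ∧ ∀ σ : ℝ, 0 < σ → σ < σ₃ → ∀ Φ : InfiniteHardSphereFlow (Fin 3) σ,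
      Φ.IsEquilibriumFlow → ∀ θ z : ℝ, 0 < θ → 0 < z →
      ∀ μ : Measure MarkedConfig, IsHardSphereGibbs σ z θ⁻¹ (0 : V3) μ → IsTranslationInvariant μ →
        PointProcess.density μ = 1 → IsLocalObservableSpace Φ μ (hardSphereObs Φ)) →
    ∃ σ₀ : ℝ, 0 < σ₀ ∧ ∀ σ : ℝ, 0 < σ → σ < σ₀ → ∀ θ : ℝ, 0 < θ →
      ∃ z : ℝ, 0 < z ∧ ∃ F : HardSphereFluctuationData σ,
        IsHardSphereGibbs σ z θ⁻¹ (0 : V3) F.μ ∧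
        (∫ ω, cellCharge 0 ω ∂F.μ = 1) ∧
        (∃ Φ : InfiniteHardSphereFlow (Fin 3) σ, Φ.IsEquilibriumFlow ∧ ∀ t : ℝ, F.flow t =ᵐ[F.μ] Φ.flow t) ∧
        cellObs (fun v : V3 => v 0 * v 1) ∈ F.localObs := by
  intro hF1 hF2 hFcov hF3
  obtain ⟨σ₁, hσ₁, H₁⟩ := hF1
  obtain ⟨σ₃, hσ₃, H₃⟩ := hF3
  refine ⟨min σ₁ σ₃, lt_min hσ₁ hσ₃, ?_⟩
  intro σ hσ hσlt θ hθ
  have h₁ : σ < σ₁ := lt_of_lt_of_le hσlt (min_le_left _ _)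
  have h₃ : σ < σ₃ := lt_of_lt_of_le hσlt (min_le_right _ _)
  obtain ⟨z, hz, μ, hμ, hti, hρ⟩ := H₁ σ hσ h₁ θ hθ
  obtain ⟨Φ, hΦ⟩ := hF2 hσ
  exact ⟨z, hz, exists_framework_of_ae hσ hθ hz hμ hti hρ hΦ
    (hFcov σ hσ Φ hΦ z θ⁻¹ hz (inv_pos.2 hθ) μ hμ) (H₃ σ hσ h₃ Φ hΦ θ z hθ hz μ hμ hti hρ)
    (cellObs_shearStress_mem_hardSphereObs Φ)⟩

end Summit.AtomisticToContinuum.HydrodynamicLimit.Theorems.MourreKoopmanChargesStressStrongMixing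

end
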